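import Literature.AnabelianGeometry.SemiGraphs.OuterSemidirectProductTopology
import Literature.AnabelianGeometry.SemiGraphs.ArithTemperedGroupOfOuterAction
import HarnessLib

/-!
# `G → G ⋊^out J` is an embedding for COMPACT centre-free `G` ([SemiAnbd] §0 p. 5)

Mochizuki, *Semi-graphs of anabelioids*, Publ. RIMS **42** (2006), §0 p. 5 [cite: MochizukiSemiAnbd2006, §0 p.5]
("the injective [since `G` is center-free!] homomorphism `G → Aut(G)`").

Companion of `OuterSemidirectProductTopology.lean` (abc-iut cell, GAP row «G-P13-GR», abc-iut-w5-d151 g4):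
the hypothesis `hcentral` of `outerSemidirectProduct.isInducing_toOuterSemidirectProduct_of` — the
subgroups `{g | ∀ x, x⁻¹ g x g⁻¹ ∈ N i}` ("central modulo the level `N i`") shrink to `1` — HOLDS
AUTOMATICALLY for a COMPACT centre-free `G` whose levels are closed and meet in `1`
(`exists_centralModLevel_subset`, a compactness argument: these closed sets are directed and meet in
the centre); hence `G → G ⋊^out J` is a topological embedding for such `G`
(`isEmbedding_toOuterSemidirectProduct_of_compact`, injectivity being abc-iut-w4-d082's
`toOuterSemidirectProduct_injective`).  Nothing here bears on [IUTchIII] Cor. 3.12.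
-/

namespace Literature.AnabelianGeometry.SemiGraphs

namespace outerSemidirectProduct

open Literature.AnabelianGeometry.EtaleTheta
open Filter Topology

universe u v w

variable {G : Type u} [Group G] [TopologicalSpace G] [IsTopologicalGroup G]

/-- **Central-modulo-level subgroups shrink to `1` in a compact centre-free group**: if `G` is compact
with trivial centre and `N` is a directed family of CLOSED levels meeting in `1`, then every neighbourhood
of `1` contains `{g | ∀ x, x⁻¹ (g x g⁻¹) ∈ N i}` for some `i` (these closed sets are directed and their
intersection is the centre). [cite: MochizukiSemiAnbd2006, §0 p.5] -/
theorem exists_centralModLevel_subset [CompactSpace G] (hZ : Subgroup.center G = ⊥)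
    {ι : Type w} [Nonempty ι] (N : ι → Subgroup G) (hdir : Directed (· ≥ ·) N)
    (hclosed : ∀ i, IsClosed ((N i : Subgroup G) : Set G)) (hinf : ∀ g : G, (∀ i, g ∈ N i) → g = 1)
    {U : Set G} (hU : U ∈ 𝓝 (1 : G)) :
    ∃ i, {g : G | ∀ x : G, x⁻¹ * (g * x * g⁻¹) ∈ N i} ⊆ U := by
  set Z : ι → Set G := fun i => {g : G | ∀ x : G, x⁻¹ * (g * x * g⁻¹) ∈ N i} with hZdef
  -- the sets are closed
  have hZc : ∀ i, IsClosed (Z i) := by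
    intro i
    have : Z i = ⋂ x : G, (fun g => x⁻¹ * (g * x * g⁻¹)) ⁻¹' (N i : Set G) := by
      ext g; simp [hZdef]
    rw [this]
    exact isClosed_iInter fun x => (hclosed i).preimage (by fun_prop)
  -- and directed
  have hZd : Directed (· ⊇ ·) Z := by
    intro i j
    obtain ⟨k, hki, hkj⟩ := hdir i j
    exact ⟨k, fun g hg x => hki (hg x), fun g hg x => hkj (hg x)⟩
  -- their intersection is the centre, i.e. `{1}`
  have hZ1 : ∀ g, (∀ i, g ∈ Z i) → g = 1 := by
    intro g hg
    have hc : g ∈ Subgroup.center G := by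
      rw [Subgroup.mem_center_iff]
      intro x
      have h1 : x⁻¹ * (g * x * g⁻¹) = 1 := hinf _ fun i => hg i x
      rw [mul_eq_one_iff_eq_inv] at h1
      -- `g x g⁻¹ = x`
      have h2 : g * x * g⁻¹ = x := inv_injective h1.symm
      calc x * g = (g * x * g⁻¹) * g := by rw [h2]
        _ = g * x := by group
    rw [hZ, Subgroup.mem_bot] at hc
    exact hc
  -- compactness: the closed complement of `interior U` misses some `Z i`
  obtain ⟨W, hWU, hWo, h1W⟩ := mem_nhds_iff.mp hU
  have hs : IsCompact Wᶜ := hWo.isClosed_compl.isCompact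
  have hempty : (Wᶜ ∩ ⋂ i, Z i) = ∅ := by
    ext g
    simp only [Set.mem_inter_iff, Set.mem_compl_iff, Set.mem_iInter, Set.mem_empty_iff_false, iff_false,
      not_and, not_forall]
    intro hgW
    by_contra h
    push Not at h
    exact hgW (hZ1 g h ▸ h1W)
  obtain ⟨i, hi⟩ := hs.elim_directed_family_closed Z hZc hempty hZd
  refine ⟨i, fun g hg => hWU ?_⟩
  by_contra hgW
  exact (Set.eq_empty_iff_forall_notMem.mp hi) g ⟨hgW, hg⟩

variable {J : Type v} [Group J] [TopologicalSpace J] [IsTopologicalGroup J]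
  (ρ : J →* TopOut G) {ι : Type w} [Nonempty ι] (N : ι → Subgroup G) (hdir : Directed (· ≥ ·) N)
  (hinv : ∀ (i : ι) (e : outerSemidirectProduct ρ) (g : G), g ∈ N i → (e.1.1 : MulAut G) g ∈ N i)

/-- **For a COMPACT centre-free `G`, `G → G ⋊^out J` is a topological EMBEDDING** for the topology along
any directed family of open (hence closed) normal levels meeting in `1` (inducing by
`isInducing_toOuterSemidirectProduct_of` + `exists_centralModLevel_subset`; injective by
abc-iut-w4-d082's `toOuterSemidirectProduct_injective`). [cite: MochizukiSemiAnbd2006, §0 p.5] -/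
theorem isEmbedding_toOuterSemidirectProduct_of_compact [CompactSpace G] (hZ : Subgroup.center G = ⊥)
    (hnormal : ∀ i, (N i).Normal) (hopen : ∀ i, IsOpen ((N i : Subgroup G) : Set G))
    (hinf : ∀ g : G, (∀ i, g ∈ N i) → g = 1) :
    @Topology.IsEmbedding _ _ _ (topology ρ N hdir hinv) (toOuterSemidirectProduct ρ) := by
  letI := topology ρ N hdir hinv
  refine ⟨isInducing_toOuterSemidirectProduct_of ρ N hdir hinv hnormal
    (fun i => (hopen i).mem_nhds (one_mem _)) fun U hU => ?_, toOuterSemidirectProduct_injective ρ hZ⟩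
  exact exists_centralModLevel_subset hZ N hdir (fun i => (N i).isClosed_of_isOpen (hopen i)) hinf hU

end outerSemidirectProduct

end Literature.AnabelianGeometry.SemiGraphs
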